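import Literature.MathematicalPhysics.QuantumLattice.HubbardCanonicalSusceptibilityBounds
import HarnessLib


/-!
# Hubbard ladder — Bounds: the BAND bound on the Kubo–Kishi double commutator and the canonical
# structure-factor ceilings at EVERY wave vector on general graphs, `T > 0` — UNCONDITIONAL
# (bounds.tex Thm 11 (A3)/(R3) in the canonical ensemble, Lemma 11.4, Cor. 11.3; typed AND proved)

HONEST FRAMING (cell pub-hubbard): ladder R1–R4 with certified numbers; no claim on H/H₀. These
are bounds for MODEL CLASSES — (A) the attractive Hubbard model `hamiltonianWith G t U μ`
(`t ≥ 0`, `U < 0`, any `μ`) on ANY finite graph `G` of maximal degree `Δ`, in the canonical Gibbs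
state of its compression to a `(k ↑, k ↓)` coordinate sector; (R) the repulsive model
`hamiltonian G t U` (`U > 0`) on any finite BIPARTITE graph in a half-filled `(k, |Λ| - k)`
sector; `β > 0`; no materials claim. The torus instances (`Δ = 4`) are the companion file
`ThermalStructureFactorCeilingCanonicalAllQ.lean`. Text: `pub-hubbard/paper/bounds.tex` Thm 11,
Lemma 11.4, Cor. 11.3, Remark 11; tables `pub-hubbard/pub-hubbard-bounds/BOUNDS.md` (rows T9ᵇ)
and `EXTREMISERS.md` §5u.

Kubo–Kishi bound the double commutator of their Falk–Bruch step by the operator norm,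
`⟨[A,[H,A]]⟩ ≤ 16|t| |Λ|` on the square lattice (Remark 3). Here the same slot is bounded by an
OPERATOR INEQUALITY read in the sector Gibbs state: for symmetric bond weights `w ≥ 0`,
`Σ_{u,v,σ} [u∼v] w(u,v) (c_{uσ} - c_{vσ})†(c_{uσ} - c_{vσ}) = 2 (D_w - T(w)) ≥ 0`,
`D_w = Σ_{u,v,σ} [u∼v] w(u,v) n_{uσ} ≤ (max_u Σ_{v∼u} w(u,v)) · N̂`, so in an `N`-particle sector
`Re⟨T(w)|_p⟩_{β,p} ≤ (max weighted degree) · N` — proportional to the particle number, not to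
the volume. With `w = (a_x - a_y)²`, `|a| ≤ 1`: `Re⟨[M_a,[H,M_a]]|_p⟩ ≤ 4tΔ · N`.

## What is proved (no `sorry`, no new axioms, no named-fact hypothesis)

* `sum_bondSquare_eq_two_smul`, `posSemidef_two_smul_sub_hoppingForm`,
  `posSemidef_smul_totalNumberOp_sub`, `re_gibbsState_hoppingForm_toBlock_le` — the band bound,
  any finite graph, any sector of `N`-particle configurations, any Hermitian block Hamiltonian.
* `re_gibbsState_spinDensityField_sq_toBlock_le_allQ` — **(A3) canonically, every `q`, every
  density, any graph**: `Re⟨(M_a|_p)²⟩_{β,p} ≤ Σa²/(β|U|) + ½ √(Σa²/|U| · 8tΔk)` in every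
  `(k ↑, k ↓)` sector, every real profile `|a_x| ≤ 1` (`M_a = Σ a_x (n_{x↑} - n_{x↓})`).
* `re_gibbsState_chargeDensityField_sq_toBlock_le_allQ` — **(R3) = KK (5) canonically, every `q`,
  bipartite graphs, half filling**: `Re⟨(N_a|_p)²⟩_{β,p} ≤ Σa²/(βU) + ½ √(Σa²/U · 4tΔ|Λ|)`.
* Nodes (`@[conjecture] def`, each proved by `…_holds`): `ThermalAttractiveSDWCeilingCanonicalGraph`,
  `ThermalMottCDWCeilingCanonicalGraph` — the two statements above as registry nodes.

Honest numbers: at half filling the band constant `4tΔ|Λ|` equals Kubo–Kishi's (`16L²` on the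
square lattice); below half filling it is smaller by the density. Finite volume, fixed particle
numbers; the thermodynamic limit and `T = 0` are not addressed. References (`lean/references.bib`):
KuboKishi1990 Thms 1–2, eqs. (3)–(5), Remark 3; LiebPRL1989 Thms 1–2; DLS1978 Lemma 4.1, Thm 3.1.
-/


noncomputable section

namespace Summit.HubbardSuperconductivity.HubbardLadder.Bounds

open Matrix Finset Real
open Literature.MathematicalPhysics.QuantumLattice
open scoped ComplexOrder ComplexConjugate

/-! ### The band bound: an operator inequality for weighted hopping forms -/

section Graph

variable {Λ : Type} [LinearOrder Λ] [Fintype Λ] (G : SimpleGraph Λ) [DecidableRel G.Adj]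

/-- **Bond sum of squares.** For symmetric bond weights,
`Σ_{u,v,σ} [u∼v] w(u,v) (c_{uσ} - c_{vσ})†(c_{uσ} - c_{vσ}) = 2 (D_w - T(w))`,
`D_w = Σ_{u,v,σ} [u∼v] w(u,v) n_{uσ}` (pure algebra: `c†_u c_u = n_u`, no anticommutation needed). -/
theorem sum_bondSquare_eq_two_smul (w : Λ → Λ → ℝ) (hws : ∀ u v, w u v = w v u) :
    (∑ u : Λ, ∑ v : Λ, ∑ σ : Fin 2, if G.Adj u v then ((w u v : ℝ) : ℂ) •
        ((annihilation (orb u σ) - annihilation (orb v σ))ᴴ *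
          (annihilation (orb u σ) - annihilation (orb v σ))) else
        (0 : Matrix (Finset (Orb Λ)) (Finset (Orb Λ)) ℂ)) =
      (2 : ℂ) • ((∑ u : Λ, ∑ v : Λ, ∑ σ : Fin 2,
          if G.Adj u v then ((w u v : ℝ) : ℂ) • numberAt (orb u σ) else
            (0 : Matrix (Finset (Orb Λ)) (Finset (Orb Λ)) ℂ)) - hoppingForm G w) := by
  have hsq : ∀ (u v : Λ) (σ : Fin 2),
      (annihilation (orb u σ) - annihilation (orb v σ))ᴴ *
          (annihilation (orb u σ) - annihilation (orb v σ)) =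
        numberAt (orb u σ) + numberAt (orb v σ) -
          (creation (orb u σ) * annihilation (orb v σ) +
            creation (orb v σ) * annihilation (orb u σ)) := by
    intro u v σ
    rw [conjTranspose_sub, annihilation_conjTranspose, annihilation_conjTranspose, sub_mul,
      mul_sub, mul_sub]
    simp only [numberAt]
    abel
  have hsummand : ∀ (u v : Λ) (σ : Fin 2),
      (if G.Adj u v then ((w u v : ℝ) : ℂ) •
        ((annihilation (orb u σ) - annihilation (orb v σ))ᴴ *
          (annihilation (orb u σ) - annihilation (orb v σ))) else
        (0 : Matrix (Finset (Orb Λ)) (Finset (Orb Λ)) ℂ)) =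
      ((if G.Adj u v then ((w u v : ℝ) : ℂ) • numberAt (orb u σ) else 0) +
        (if G.Adj v u then ((w v u : ℝ) : ℂ) • numberAt (orb v σ) else 0)) -
      ((if G.Adj u v then ((w u v : ℝ) : ℂ) • (creation (orb u σ) * annihilation (orb v σ))
          else 0) +
        (if G.Adj v u then ((w v u : ℝ) : ℂ) • (creation (orb v σ) * annihilation (orb u σ))
          else 0)) := by
    intro u v σ
    by_cases h : G.Adj u v
    · rw [if_pos h, if_pos h, if_pos h.symm, if_pos h, if_pos h.symm, hws v u, hsq, smul_sub,
        smul_add, smul_add]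
    · have h' : ¬ G.Adj v u := fun h' => h h'.symm
      rw [if_neg h, if_neg h, if_neg h', if_neg h, if_neg h', add_zero, sub_zero]
  have hA : (∑ u : Λ, ∑ v : Λ, ∑ σ : Fin 2,
      if G.Adj v u then ((w v u : ℝ) : ℂ) • numberAt (orb v σ) else
        (0 : Matrix (Finset (Orb Λ)) (Finset (Orb Λ)) ℂ)) =
      ∑ u : Λ, ∑ v : Λ, ∑ σ : Fin 2,
        if G.Adj u v then ((w u v : ℝ) : ℂ) • numberAt (orb u σ) else 0 := Finset.sum_comm
  have hC : (∑ u : Λ, ∑ v : Λ, ∑ σ : Fin 2,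
      if G.Adj v u then ((w v u : ℝ) : ℂ) • (creation (orb v σ) * annihilation (orb u σ)) else
        (0 : Matrix (Finset (Orb Λ)) (Finset (Orb Λ)) ℂ)) = hoppingForm G w := by
    rw [hoppingForm_eq]; exact Finset.sum_comm
  calc _ = ∑ u : Λ, ∑ v : Λ, ∑ σ : Fin 2,
        (((if G.Adj u v then ((w u v : ℝ) : ℂ) • numberAt (orb u σ) else
            (0 : Matrix (Finset (Orb Λ)) (Finset (Orb Λ)) ℂ)) +
          (if G.Adj v u then ((w v u : ℝ) : ℂ) • numberAt (orb v σ) else 0)) -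
        ((if G.Adj u v then ((w u v : ℝ) : ℂ) • (creation (orb u σ) * annihilation (orb v σ))
            else 0) +
          (if G.Adj v u then ((w v u : ℝ) : ℂ) • (creation (orb v σ) * annihilation (orb u σ))
            else 0))) :=
        Finset.sum_congr rfl fun u _ => Finset.sum_congr rfl fun v _ =>
          Finset.sum_congr rfl fun σ _ => hsummand u v σ
    _ = _ := by
      simp only [Finset.sum_add_distrib, Finset.sum_sub_distrib]
      rw [hA, hC, ← hoppingForm_eq, two_smul]
      abel

/-- **`2 (D_w - T(w)) ≥ 0`** for symmetric non-negative bond weights: the hopping form is dominated,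
as an operator, by the weighted number operator `D_w = Σ_{u,σ} (Σ_{v∼u} w(u,v)) n_{uσ}`. -/
theorem posSemidef_two_smul_sub_hoppingForm (w : Λ → Λ → ℝ) (hws : ∀ u v, w u v = w v u)
    (hw0 : ∀ u v, G.Adj u v → 0 ≤ w u v) :
    ((2 : ℂ) • ((∑ u : Λ, ∑ v : Λ, ∑ σ : Fin 2,
        if G.Adj u v then ((w u v : ℝ) : ℂ) • numberAt (orb u σ) else
          (0 : Matrix (Finset (Orb Λ)) (Finset (Orb Λ)) ℂ)) - hoppingForm G w)).PosSemidef := by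
  rw [← sum_bondSquare_eq_two_smul G w hws]
  refine posSemidef_sum _ fun u _ => posSemidef_sum _ fun v _ => posSemidef_sum _ fun σ _ => ?_
  split_ifs with h
  · exact (posSemidef_conjTranspose_mul_self _).smul (Complex.zero_le_real.2 (hw0 u v h))
  · exact PosSemidef.zero

/-- **`D_w ≤ W · N̂`** as operators when every weighted degree `Σ_{v∼u} w(u,v)` is `≤ W`
(`N̂ = Σ_i n_i` the total number operator; each `n_{uσ} = c† c ≥ 0`). -/
theorem posSemidef_smul_totalNumberOp_sub (w : Λ → Λ → ℝ) {W : ℝ}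
    (hd : ∀ u, (∑ v, if G.Adj u v then w u v else 0) ≤ W) :
    (((W : ℝ) : ℂ) • (totalNumberOp : Matrix (Finset (Orb Λ)) (Finset (Orb Λ)) ℂ) -
      ∑ u : Λ, ∑ v : Λ, ∑ σ : Fin 2,
        if G.Adj u v then ((w u v : ℝ) : ℂ) • numberAt (orb u σ) else
          (0 : Matrix (Finset (Orb Λ)) (Finset (Orb Λ)) ℂ)).PosSemidef := by
  set d : Λ → ℝ := fun u => ∑ v, if G.Adj u v then w u v else 0 with hd_def
  have hdcast : ∀ u, ((d u : ℝ) : ℂ) = ∑ v, if G.Adj u v then ((w u v : ℝ) : ℂ) else 0 := by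
    intro u
    simp only [hd_def, Complex.ofReal_sum, apply_ite Complex.ofReal, Complex.ofReal_zero]
  have hN : (totalNumberOp : Matrix (Finset (Orb Λ)) (Finset (Orb Λ)) ℂ) =
      ∑ u : Λ, ∑ σ : Fin 2, numberAt (orb u σ) := by
    rw [totalNumberOp_eq_totalNumber]; rfl
  have hD : (∑ u : Λ, ∑ v : Λ, ∑ σ : Fin 2,
      if G.Adj u v then ((w u v : ℝ) : ℂ) • numberAt (orb u σ) else
        (0 : Matrix (Finset (Orb Λ)) (Finset (Orb Λ)) ℂ)) =
      ∑ u : Λ, ∑ σ : Fin 2, ((d u : ℝ) : ℂ) • numberAt (orb u σ) := by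
    refine Finset.sum_congr rfl fun u _ => ?_
    rw [Finset.sum_comm]
    refine Finset.sum_congr rfl fun σ _ => ?_
    rw [hdcast u, Finset.sum_smul]
    refine Finset.sum_congr rfl fun v _ => ?_
    split_ifs <;> simp
  rw [hN, hD, Finset.smul_sum, ← Finset.sum_sub_distrib]
  refine posSemidef_sum _ fun u _ => ?_
  rw [Finset.smul_sum, ← Finset.sum_sub_distrib]
  refine posSemidef_sum _ fun σ _ => ?_
  rw [← sub_smul, ← Complex.ofReal_sub]
  exact (posSemidef_conjTranspose_mul_self (annihilation (orb u σ))).smul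
    (Complex.zero_le_real.2 (sub_nonneg.2 (hd u)))

variable {G} in
/-- **The band bound in a sector Gibbs state.** For symmetric bond weights `w ≥ 0` with weighted
degrees `≤ W`, a coordinate sector `p` of `N`-particle configurations and any Hamiltonian whose block
`A|_p` is Hermitian: `Re⟨T(w)|_p⟩_{β, A|_p} ≤ W · N` (Gibbs positivity on `(W N̂ - T(w))|_p ≥ 0`,
`N̂|_p = N · 1`). Replaces the operator-norm (degree × volume) bound of Kubo–Kishi's Remark 3 by
degree × particle number. -/
theorem re_gibbsState_hoppingForm_toBlock_le (w : Λ → Λ → ℝ) (hws : ∀ u v, w u v = w v u)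
    (hw0 : ∀ u v, G.Adj u v → 0 ≤ w u v) {W : ℝ}
    (hd : ∀ u, (∑ v, if G.Adj u v then w u v else 0) ≤ W) {β : ℝ}
    {A : Matrix (Finset (Orb Λ)) (Finset (Orb Λ)) ℂ} (p : Finset (Orb Λ) → Prop) [DecidablePred p]
    [Nonempty {s // p s}] (hA : (A.toBlock p p).IsHermitian) {N : ℕ}
    (hpN : ∀ s, p s → s.card = N) :
    (gibbsState β (A.toBlock p p) ((hoppingForm G w).toBlock p p)).re ≤ W * N := by
  have h1 := posSemidef_two_smul_sub_hoppingForm G w hws hw0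
  have h2 := posSemidef_smul_totalNumberOp_sub G w hd
  have h2c : (0 : ℂ) ≤ (2 : ℂ) := by
    rw [show (2 : ℂ) = ((2 : ℝ) : ℂ) by norm_num]; exact Complex.zero_le_real.2 (by norm_num)
  have hhalf : (0 : ℂ) ≤ ((1 / 2 : ℝ) : ℂ) := Complex.zero_le_real.2 (by norm_num)
  have h12 : ((2 : ℂ) • ((((W : ℝ) : ℂ) • (totalNumberOp : Matrix (Finset (Orb Λ)) (Finset (Orb Λ)) ℂ))
      - hoppingForm G w)).PosSemidef := by
    have e : (2 : ℂ) • ((((W : ℝ) : ℂ) •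
        (totalNumberOp : Matrix (Finset (Orb Λ)) (Finset (Orb Λ)) ℂ)) - hoppingForm G w) =
        (2 : ℂ) • ((((W : ℝ) : ℂ) • (totalNumberOp : Matrix (Finset (Orb Λ)) (Finset (Orb Λ)) ℂ)) -
          ∑ u : Λ, ∑ v : Λ, ∑ σ : Fin 2,
            if G.Adj u v then ((w u v : ℝ) : ℂ) • numberAt (orb u σ) else
              (0 : Matrix (Finset (Orb Λ)) (Finset (Orb Λ)) ℂ)) +
        (2 : ℂ) • ((∑ u : Λ, ∑ v : Λ, ∑ σ : Fin 2,
            if G.Adj u v then ((w u v : ℝ) : ℂ) • numberAt (orb u σ) else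
              (0 : Matrix (Finset (Orb Λ)) (Finset (Orb Λ)) ℂ)) - hoppingForm G w) := by
      rw [← smul_add]; congr 1; abel
    rw [e]
    exact (h2.smul h2c).add h1
  have hX : ((((W : ℝ) : ℂ) • (totalNumberOp : Matrix (Finset (Orb Λ)) (Finset (Orb Λ)) ℂ))
      - hoppingForm G w).PosSemidef := by
    have h := h12.smul hhalf
    rwa [smul_smul, show ((1 / 2 : ℝ) : ℂ) * 2 = 1 by push_cast; ring, one_smul] at h
  have hNblk : (totalNumberOp : Matrix (Finset (Orb Λ)) (Finset (Orb Λ)) ℂ).toBlock p p =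
      ((N : ℕ) : ℂ) • (1 : Matrix {s // p s} {s // p s} ℂ) := by
    rw [totalNumberOp_eq_diagonal, toBlock_diagonal_self]
    ext i j
    by_cases hij : i = j
    · subst hij; simp [hpN i.1 i.2]
    · simp [hij]
  have hblk := gibbsState_nonneg_of_posSemidef β hA
    (hX.submatrix (Subtype.val : {s // p s} → Finset (Orb Λ)))
  rw [show ((((W : ℝ) : ℂ) • (totalNumberOp : Matrix (Finset (Orb Λ)) (Finset (Orb Λ)) ℂ)) -
      hoppingForm G w).submatrix (Subtype.val : {s // p s} → Finset (Orb Λ)) Subtype.val =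
      ((W : ℝ) : ℂ) • (totalNumberOp : Matrix (Finset (Orb Λ)) (Finset (Orb Λ)) ℂ).toBlock p p -
        (hoppingForm G w).toBlock p p from rfl, hNblk, smul_smul, map_sub, map_smul,
    gibbsState_one β _ (partitionFn_pos β hA).ne', smul_eq_mul, mul_one] at hblk
  have hre := (Complex.nonneg_iff.1 hblk).1
  simp only [Complex.sub_re, Complex.mul_re, Complex.ofReal_re, Complex.ofReal_im,
    Complex.natCast_re, Complex.natCast_im, mul_zero, sub_zero] at hre
  linarith

omit [LinearOrder Λ] in
/-- Weighted degrees of the square-gradient weights of a bounded profile: `|a| ≤ 1` and degree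
`≤ Δ` give `Σ_{v∼u} (a_u - a_v)² ≤ 4Δ`. -/
theorem sum_adj_sq_sub_le {Δ : ℕ} (hdeg : ∀ u, (univ.filter (G.Adj u)).card ≤ Δ) (a : Λ → ℝ)
    (ha : ∀ x, |a x| ≤ 1) (u : Λ) :
    (∑ v, if G.Adj u v then (a u - a v) ^ 2 else 0) ≤ 4 * Δ := by
  have h4 : ∀ v, (a u - a v) ^ 2 ≤ 4 := by
    intro v
    have hu := abs_le.1 (ha u)
    have hv := abs_le.1 (ha v)
    have h := sq_le_sq' (a := a u - a v) (b := 2) (by linarith) (by linarith)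
    linarith
  calc (∑ v, if G.Adj u v then (a u - a v) ^ 2 else 0) ≤ ∑ v, if G.Adj u v then (4 : ℝ) else 0 :=
        Finset.sum_le_sum fun v _ => by
          by_cases h : G.Adj u v
          · rw [if_pos h, if_pos h]; exact h4 v
          · rw [if_neg h, if_neg h]
    _ = 4 * (univ.filter (G.Adj u)).card := by
        rw [Finset.sum_ite, Finset.sum_const_zero, add_zero, Finset.sum_const, nsmul_eq_mul,
          mul_comm]
    _ ≤ 4 * Δ := by exact_mod_cast Nat.mul_le_mul_left 4 (hdeg u)

variable {G} in
/-- **(A3) canonically at every wave vector, any graph.** Attractive `hamiltonianWith G t U μ`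
(`t ≥ 0`, `U < 0`), degree `≤ Δ`, `p` any presentation of the `(k ↑, k ↓)` sector, `|a| ≤ 1`:
`Re⟨(M_a|_p)²⟩_{β,p} ≤ Σa²/(β|U|) + ½ √(Σa²/|U| · 8tΔk)` — Kubo–Kishi's Falk–Bruch step in the
sector (`hubbard_attractive_sector_falkBruch_le`), the block f-sum identity
(`spinDensityField_doubleComm_toBlock_eq`) and the band bound (`re_gibbsState_hoppingForm_toBlock_le`,
`N = 2k`). -/
theorem re_gibbsState_spinDensityField_sq_toBlock_le_allQ {t U μ β : ℝ} (ht : 0 ≤ t) (hU : U < 0)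
    (hβ : 0 < β) {Δ : ℕ} (hdeg : ∀ u, (univ.filter (G.Adj u)).card ≤ Δ) {k : ℕ}
    (p : Finset (Orb Λ) → Prop) [DecidablePred p]
    (hp : ∀ s, p s ↔ (upPart s).card = k ∧ (downPart s).card = k) [Nonempty {s // p s}]
    (a : Λ → ℝ) (ha : ∀ x, |a x| ≤ 1) :
    (gibbsState β ((hamiltonianWith G t U μ).toBlock p p)
        ((spinDensityField a).toBlock p p * (spinDensityField a).toBlock p p)).re ≤
      (∑ x, a x ^ 2) / |U| / β + 1 / 2 * Real.sqrt ((∑ x, a x ^ 2) / |U| * (8 * t * Δ * k)) := by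
  have h := hubbard_attractive_sector_falkBruch_le G (t := t) (μ := μ) hU hβ p hp (ι := Unit)
    (fun _ => a)
  simp only [Finset.univ_unique, Finset.sum_singleton] at h
  rw [spinDensityField_doubleComm_toBlock_eq G a t U μ p hp] at h
  have hpN : ∀ s, p s → s.card = 2 * k := fun s hs => by
    rw [card_eq_upPart_add_downPart, ((hp s).1 hs).1, ((hp s).1 hs).2]; ring
  have hA : ((hamiltonianWith G t U μ).toBlock p p).IsHermitian :=
    (isHermitian_hamiltonianWith G t U μ).submatrix _
  have hband := re_gibbsState_hoppingForm_toBlock_le (β := β) (fun x y => (a x - a y) ^ 2)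
    (fun u v => by ring) (fun u v _ => sq_nonneg _) (sum_adj_sq_sub_le G hdeg a ha) p hA hpN
  have hdc : (gibbsState β ((hamiltonianWith G t U μ).toBlock p p)
      (((t : ℂ) • hoppingForm G fun x y => (a x - a y) ^ 2).toBlock p p)).re ≤ 8 * t * Δ * k := by
    rw [show (((t : ℂ) • hoppingForm G fun x y => (a x - a y) ^ 2).toBlock p p) =
      (t : ℂ) • (hoppingForm G fun x y => (a x - a y) ^ 2).toBlock p p from rfl, map_smul,
      smul_eq_mul, Complex.re_ofReal_mul]
    push_cast at hband
    nlinarith [mul_le_mul_of_nonneg_left hband ht]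
  have hB : 0 ≤ (∑ x, a x ^ 2) / |U| :=
    div_nonneg (Finset.sum_nonneg fun x _ => sq_nonneg _) (abs_nonneg _)
  have hs := Real.sqrt_le_sqrt (mul_le_mul_of_nonneg_left hdc hB)
  linarith

variable {G} in
/-- **(R3) = Kubo–Kishi (5) canonically at every wave vector, bipartite graphs, half filling.**
Repulsive `hamiltonian G t U` (`t ≥ 0`, `U > 0`), `G` bipartite (`ε` a sublattice sign), degree
`≤ Δ`, `p` any presentation of a half-filled `(k, |Λ| - k)` sector, `|a| ≤ 1`:
`Re⟨(N_a|_p)²⟩_{β,p} ≤ Σa²/(βU) + ½ √(Σa²/U · 4tΔ|Λ|)` (`hubbard_repulsive_halfFilledSector_falkBruch_le`,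
`chargeDensityField_doubleComm_toBlock_eq`, band bound with `N = |Λ|`). -/
theorem re_gibbsState_chargeDensityField_sq_toBlock_le_allQ (ε : Λ → ℤˣ)
    (hε : ∀ x y, G.Adj x y → ε x = -ε y) {t U β : ℝ} (ht : 0 ≤ t) (hU : 0 < U) (hβ : 0 < β)
    {Δ : ℕ} (hdeg : ∀ u, (univ.filter (G.Adj u)).card ≤ Δ) {k l : ℕ}
    (hkl : k + l = Fintype.card Λ) (p : Finset (Orb Λ) → Prop) [DecidablePred p]
    (hp : ∀ s, p s ↔ (upPart s).card = k ∧ (downPart s).card = l) [Nonempty {s // p s}]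
    (a : Λ → ℝ) (ha : ∀ x, |a x| ≤ 1) :
    (gibbsState β ((hamiltonian G t U).toBlock p p)
        ((chargeDensityField a).toBlock p p * (chargeDensityField a).toBlock p p)).re ≤
      (∑ x, a x ^ 2) / U / β +
        1 / 2 * Real.sqrt ((∑ x, a x ^ 2) / U * (4 * t * Δ * Fintype.card Λ)) := by
  have h := hubbard_repulsive_halfFilledSector_falkBruch_le G ε hε (t := t) hU hβ hkl p hp
    (ι := Unit) (fun _ => a)
  simp only [Finset.univ_unique, Finset.sum_singleton] at h
  rw [chargeDensityField_doubleComm_toBlock_eq G a t U p hp] at h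
  have hpN : ∀ s, p s → s.card = Fintype.card Λ := fun s hs => by
    rw [card_eq_upPart_add_downPart, ((hp s).1 hs).1, ((hp s).1 hs).2, hkl]
  have hA : ((hamiltonian G t U).toBlock p p).IsHermitian := by
    have h0 := isHermitian_hamiltonianWith G t U 0
    rw [hamiltonianWith_zero] at h0
    exact h0.submatrix _
  have hband := re_gibbsState_hoppingForm_toBlock_le (β := β) (fun x y => (a x - a y) ^ 2)
    (fun u v => by ring) (fun u v _ => sq_nonneg _) (sum_adj_sq_sub_le G hdeg a ha) p hA hpN
  have hdc : (gibbsState β ((hamiltonian G t U).toBlock p p)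
      (((t : ℂ) • hoppingForm G fun x y => (a x - a y) ^ 2).toBlock p p)).re ≤
      4 * t * Δ * Fintype.card Λ := by
    rw [show (((t : ℂ) • hoppingForm G fun x y => (a x - a y) ^ 2).toBlock p p) =
      (t : ℂ) • (hoppingForm G fun x y => (a x - a y) ^ 2).toBlock p p from rfl, map_smul,
      smul_eq_mul, Complex.re_ofReal_mul]
    nlinarith [mul_le_mul_of_nonneg_left hband ht]
  have hB : 0 ≤ (∑ x, a x ^ 2) / U :=
    div_nonneg (Finset.sum_nonneg fun x _ => sq_nonneg _) hU.le
  have hs := Real.sqrt_le_sqrt (mul_le_mul_of_nonneg_left hdc hB)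
  linarith

/-- Node: **(A3) canonically at every wave vector, on any finite graph** (UNCONDITIONAL): the
attractive Hubbard model `hamiltonianWith G t U μ` (`t ≥ 0`, `U < 0`, any `μ`), maximal degree
`≤ Δ`, any non-empty presentation `p` of the `(k ↑, k ↓)` sector, any profile `|a| ≤ 1`:
`Re⟨(M_a|_p)²⟩_{β,p} ≤ Σa² T/|U| + ½ √(Σa²/|U| · 8tΔk)`. kind: support (PROVED,
`re_gibbsState_spinDensityField_sq_toBlock_le_allQ`). Why it might fail: it cannot; informative only
for `|U| ≳ 4tΔ`. Sources: KuboKishi1990 Thm 1, Remark 3; LiebPRL1989 Thm 1; DLS1978 Thm 3.1. -/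
@[conjecture] def ThermalAttractiveSDWCeilingCanonicalGraph : Prop :=
  ∀ (Λ : Type) [LinearOrder Λ] [Fintype Λ] (G : SimpleGraph Λ) [DecidableRel G.Adj]
    (t U μ β : ℝ) (Δ k : ℕ) (p : Finset (Orb Λ) → Prop) [DecidablePred p] (a : Λ → ℝ),
    0 ≤ t → U < 0 → 0 < β → (∀ u, (univ.filter (G.Adj u)).card ≤ Δ) →
    (∀ s, p s ↔ (upPart s).card = k ∧ (downPart s).card = k) → Nonempty {s // p s} →
    (∀ x, |a x| ≤ 1) →
    (gibbsState β ((hamiltonianWith G t U μ).toBlock p p)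
        ((spinDensityField a).toBlock p p * (spinDensityField a).toBlock p p)).re ≤
      (∑ x, a x ^ 2) / (-U) / β + 1 / 2 * Real.sqrt ((∑ x, a x ^ 2) / (-U) * (8 * t * Δ * k))

/-- **`ThermalAttractiveSDWCeilingCanonicalGraph` holds.** -/
theorem thermalAttractiveSDWCeilingCanonicalGraph_holds :
    ThermalAttractiveSDWCeilingCanonicalGraph := by
  intro Λ _ _ G _ t U μ β Δ k p _ a ht hU hβ hdeg hp hne ha
  have h := re_gibbsState_spinDensityField_sq_toBlock_le_allQ (μ := μ) ht hU hβ hdeg p hp a ha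
  rwa [abs_of_neg hU] at h

/-- Node: **(R3) = Kubo–Kishi (5) canonically at every wave vector, on any finite bipartite graph**
(UNCONDITIONAL): the repulsive model `hamiltonian G t U` (`t ≥ 0`, `U > 0`), `ε` a sublattice
sign, maximal degree `≤ Δ`, any non-empty presentation `p` of a half-filled `(k, |Λ| - k)` sector,
any profile `|a| ≤ 1`: `Re⟨(N_a|_p)²⟩_{β,p} ≤ Σa² T/U + ½ √(Σa²/U · 4tΔ|Λ|)`. kind: support
(PROVED, `re_gibbsState_chargeDensityField_sq_toBlock_le_allQ`). Why it might fail: it cannot;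
informative only for `U ≳ 4tΔ`. Sources: KuboKishi1990 Thm 2 eq. (5), Remark 3; LiebPRL1989
Thm 2; DLS1978 Thm 3.1. -/
@[conjecture] def ThermalMottCDWCeilingCanonicalGraph : Prop :=
  ∀ (Λ : Type) [LinearOrder Λ] [Fintype Λ] (G : SimpleGraph Λ) [DecidableRel G.Adj] (ε : Λ → ℤˣ)
    (t U β : ℝ) (Δ k l : ℕ) (p : Finset (Orb Λ) → Prop) [DecidablePred p] (a : Λ → ℝ),
    (∀ x y, G.Adj x y → ε x = -ε y) → 0 ≤ t → 0 < U → 0 < β →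
    (∀ u, (univ.filter (G.Adj u)).card ≤ Δ) → k + l = Fintype.card Λ →
    (∀ s, p s ↔ (upPart s).card = k ∧ (downPart s).card = l) → Nonempty {s // p s} →
    (∀ x, |a x| ≤ 1) →
    (gibbsState β ((hamiltonian G t U).toBlock p p)
        ((chargeDensityField a).toBlock p p * (chargeDensityField a).toBlock p p)).re ≤
      (∑ x, a x ^ 2) / U / β +
        1 / 2 * Real.sqrt ((∑ x, a x ^ 2) / U * (4 * t * Δ * Fintype.card Λ))

/-- **`ThermalMottCDWCeilingCanonicalGraph` holds.** -/
theorem thermalMottCDWCeilingCanonicalGraph_holds : ThermalMottCDWCeilingCanonicalGraph := by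
  intro Λ _ _ G _ ε t U β Δ k l p _ a hε ht hU hβ hdeg hkl hp hne ha
  exact re_gibbsState_chargeDensityField_sq_toBlock_le_allQ ε hε ht hU hβ hdeg hkl p hp a ha

end Graph

end Summit.HubbardSuperconductivity.HubbardLadder.Bounds

end
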